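import Summits.ABC.ABC.Theorems.TwistAmplificationMazurKaneLawKloostermanDepth
import Summits.ABC.ABC.Theorems.TwistAmplificationMazurKaneLawStubTransfer
import Summits.ABC.ABC.Theorems.TwistAmplificationMazurKaneLawStubOffWall
import Summits.ABC.ABC.Theorems.TwistAmplificationMazurKaneLawStubTwoRootTameX
import Summits.ABC.ABC.Theorems.TwistAmplificationMazurKaneLawStubTwoRootTameZ
import Summits.ABC.ABC.Theorems.TwistAmplificationMazurKaneLawToolkitCertifiedLaw

-- Summit.ABC.ABC is the mandated summit-side namespace (single-conjunct summit); the lakefile sets the same option tree-wide.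
set_option linter.dupNamespace false

/-!
# The reach of line `critical-kloosterman-powerful-moduli` as theorems (crux stmt-ABC-2757 `MazurKaneLaw`)

Lead c4 (prover-line-stmt-ABC-2757-c4-0, 2026-08-16). The fallback skeleton
`Cruxes/MazurKaneLaw/Lines/critical_kloosterman_powerful_moduli.lean` (lead -2 v2, lead c3 wave 1) composes SIX
registered stubs into the crux `Summit.ABC.ABC.Theses.TwistAmplification.MazurKaneLaw`; four of them are landed
theorems of this directory — `stub_transfer` (…StubTransfer), `stub_offWall` (…StubOffWall), `stub_twoRootTameX`
(…StubTwoRootTameX), `stub_twoRootTameZ` (…StubTwoRootTameZ) — and two are OPEN: `stub_nearWallR2` (the lever: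
the shape law on near-wall data of linear depth `≤ C₀^{1/4}` carrying no geometry-of-numbers / conic / two-root
certificate — by the exact LP of the enlarged fibre toolkit exactly the conic families `R(δ,1)`, `R(δ,2)` of
`NegativeKitPlateauSixteenNinths.md` and their neighbourhoods) and `stub_deepResidual` (the foreign residual:
depth `> C₀^{1/4}`, empty for `l ≥ 15/8`). This file turns the skeleton's `sorry`-guarded composition into
`sorry`-free IMPLICATION THEOREMS with the open stubs as explicit hypotheses (their registered signatures verbatim,
unfolded — no `def`), so that the line's content is importable and any future proof of the lever closes a range of
the Mazur–Kane law BY NAME: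

* `mazurKaneLaw_of_nearWallR2_of_deepResidual` — `stub_nearWallR2 → stub_deepResidual → MazurKaneLaw`
  (the whole composition; pure logic over the four landed stubs);
* (`…KloostermanDepth.not_deep_of_depth` — the depth-parametric emptiness lemma: for admissible data at an
  exponent `l ∈ [2 - τ/2, 2)`, "not off-wall" forces linear depth `≤ C₀^τ`, `P ≤ 2R·C₀^τ·P₀`;)
* `lawAt_tail_of_nearWallR2_depth` — THE DEPTH-PARAMETRIC REACH: for every `τ`, the near-wall-residue law AT
  DEPTH `τ` (the lever's statement with `C₀^{1/4}` replaced by `C₀^τ`), assumed only for `l ∈ [2 - τ/2, 2)`,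
  gives the Mazur–Kane law at every `s ∈ [2 - τ/2, 2)`, `1 < s`. So a critical saving proved at ANY depth `τ > 0`
  yields a kernel-checked range of the law below Kane's `s ≥ 2`;
* `lawAt_tail_of_nearWallR2` — the registered depth `1/4`: `stub_nearWallR2` alone gives the law on `[15/8, 2)`.

Glue: `two_le_numShapes`, `admissible_swap`, `not_deep_of_depth` from `…KloostermanDepth`; `shapeCount_swap` from
`…ToolkitCertifiedLaw`; the case analysis is adapted from the skeleton's `nearWallAt_of_twoRoot` /
`lawAt_of_offWall_nearWall` / `MazurKaneLaw_of` (Cruxes/MazurKaneLaw/Lines/critical_kloosterman_powerful_moduli.lean).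
-/

noncomputable section

open Finset
open Literature.NumberTheory.DiophantineGeometry
open Literature.NumberTheory.DiophantineGeometry.AbcShapes

namespace Summit.ABC.ABC.Theorems.MazurKaneLaw

/-! ## The reach of the line as implication theorems -/

/-- **THE DEPTH-PARAMETRIC REACH OF THE LINE.** Fix `τ : ℝ`. Suppose the near-wall-residue law AT DEPTH `τ`:
for every exponent `l ∈ [2 - τ/2, 2)` with `1 < l`, every `0 < ε < 1/2`, `η > 0`, some `K` bounds
`B_M ≤ K C₀^{l-1+3ε+η}` on all `(l, ε)`-admissible shape data that are NOT off-wall (no geometry-of-numbers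
certificate `P ≤ 2R·P₀`, no conic certificate `P ≤ 2R·P₁ ∧ P³ ≤ 64R³·A`), have linear depth `≤ C₀^τ`
(`P ≤ 2R·C₀^τ·P₀`), and carry NO two-root certificate for any host (`¬(CertX ∨ CertY ∨ CertZ)`) — this is the
registered `stub_nearWallR2` with its literal `1/4` replaced by `τ`. Then the Mazur–Kane law holds at every
`s ∈ [2 - τ/2, 2)`, `1 < s`: `#{abc, c ≤ N, rad(abc) ≤ c^s} ≤ C N^{s-1+ε}`. Proof: `stub_transfer` reduces the law
at `s` to the shape law at each `l ∈ (s, 2)`; there, off-wall data are `stub_offWall`, two-root-certified data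
are `stub_twoRootTameX` (host `Y` via `shapeCount_swap` on the swapped datum) and `stub_twoRootTameZ`, the deep
region is empty (`not_deep_of_depth`, as `l > s ≥ 2 - τ/2`), and the rest is the hypothesis. [folklore] -/
theorem lawAt_tail_of_nearWallR2_depth : ∀ τ : ℝ, (∀ l : ℝ, 1 < l → 2 - τ / 2 ≤ l → l < 2 → ∀ ε : ℝ, 0 < ε → ε < 1 / 2 → ∀ η : ℝ, 0 < η → ∃ K : ℝ, ∀ (C₀ c₁ c₂ c₃ : ℕ) (X Y Z : Fin (Literature.NumberTheory.DiophantineGeometry.AbcShapes.numShapes ε) → ℕ) (i₀ i₁ : Fin (Literature.NumberTheory.DiophantineGeometry.AbcShapes.numShapes ε)), (i₀ : ℕ) = 0 → (i₁ : ℕ) = 1 → Literature.NumberTheory.DiophantineGeometry.AbcShapes.Admissible l ε C₀ c₁ c₂ c₃ X Y Z → ¬ ((∏ i, ((X i : ℝ) * Y i * Z i)) ≤ 2 * (C₀ : ℝ) ^ (l - 1 + 3 * ε) * ((X i₀ : ℝ) * Y i₀ * Z i₀) ∨ ((∏ i, ((X i : ℝ) * Y i * Z i)) ≤ 2 * (C₀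 : ℝ) ^ (l - 1 + 3 * ε) * ((X i₁ : ℝ) * Y i₁ * Z i₁) ∧ (∏ i, ((X i : ℝ) * Y i * Z i)) ^ 3 ≤ 64 * ((C₀ : ℝ) ^ (l - 1 + 3 * ε)) ^ 3 * (((c₁ * Literature.NumberTheory.DiophantineGeometry.AbcShapes.shapeVal X : ℕ) : ℝ) * ((c₂ * Literature.NumberTheory.DiophantineGeometry.AbcShapes.shapeVal Y : ℕ) : ℝ) * ((c₃ * Literature.NumberTheory.DiophantineGeometry.AbcShapes.shapeVal Z : ℕ) : ℝ)))) → ((∏ i, ((X i : ℝ) * Y i * Z i)) ≤ 2 * (C₀ : ℝ) ^ (l - 1 + 3 * ε) * (C₀ : ℝ) ^ τ * ((X i₀ : ℝ) * Y i₀ * Z i₀)) → ¬ (((∏ i, ((X i : ℝ) * Y i * Z i)) ≤ 2 * (C₀ : ℝ) ^ (l - 1 + 3 * ε) * ((X i₀ : ℝ) * Y i₁ * Z i₁) ∧ (∏ i, ((X i : ℝ) * Y i * Z i)) ≤ (C₀ : ℝ) ^ (l - 1 + 3 * ε) * ((c₁ * Literature.NumberTheory.DiophantineGeometry.AbcShapes.shapeVal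 X : ℕ) : ℝ)) ∨ ((∏ i, ((X i : ℝ) * Y i * Z i)) ≤ 2 * (C₀ : ℝ) ^ (l - 1 + 3 * ε) * ((Y i₀ : ℝ) * X i₁ * Z i₁) ∧ (∏ i, ((X i : ℝ) * Y i * Z i)) ≤ (C₀ : ℝ) ^ (l - 1 + 3 * ε) * ((c₂ * Literature.NumberTheory.DiophantineGeometry.AbcShapes.shapeVal Y : ℕ) : ℝ)) ∨ ((∏ i, ((X i : ℝ) * Y i * Z i)) ≤ 2 * (C₀ : ℝ) ^ (l - 1 + 3 * ε) * ((Z i₀ : ℝ) * X i₁ * Y i₁))) → (Literature.NumberTheory.DiophantineGeometry.AbcShapes.shapeCount c₁ c₂ c₃ X Y Z : ℝ) ≤ K * (C₀ : ℝ) ^ (l - 1 + 3 * ε + η)) → ∀ s : ℝ, 1 < s → 2 - τ / 2 ≤ s → s < 2 → ∀ ε : ℝ, 0 < ε → ∃ C : ℝ, ∀ N : ℕ, 2 ≤ N → (Set.ncard {t : ℕ × ℕ × ℕ | Literature.NumberTheory.DiophantineGeometry.IsABCTriple t.1 t.2.1 t.2.2 ∧ t.2.2 ≤ N ∧ ((Literature.NumberTheory.DiophantineGeometry.rad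 t.1 t.2.1 t.2.2 : ℕ) : ℝ) ≤ (t.2.2 : ℝ) ^ s} : ℝ) ≤ C * (N : ℝ) ^ (s - 1 + ε) := by
  intro τ hR s hs1 hsτ hs2
  refine stub_transfer s hs1 hs2 fun l hl1 hl2 => ?_
  intro ε hε hε2 η hη
  have hl0 : 1 < l := lt_trans hs1 hl1
  obtain ⟨K₁, hK₁⟩ := stub_offWall l hl0 hl2 ε hε hε2 η hη
  obtain ⟨K₂, hK₂⟩ := stub_twoRootTameX l hl0 hl2 ε hε hε2 η hη
  obtain ⟨K₃, hK₃⟩ := stub_twoRootTameZ l hl0 hl2 ε hε hε2 η hη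
  obtain ⟨K₄, hK₄⟩ := hR l hl0 (by linarith) hl2 ε hε hε2 η hη
  have h2 := two_le_numShapes hε hε2
  refine ⟨max (max K₁ K₂) (max K₃ K₄), fun C₀ c₁ c₂ c₃ X Y Z hA => ?_⟩
  set i₀ : Fin (numShapes ε) := ⟨0, by omega⟩ with hi₀
  set i₁ : Fin (numShapes ε) := ⟨1, by omega⟩ with hi₁
  have hC : (0 : ℝ) ≤ (C₀ : ℝ) ^ (l - 1 + 3 * ε + η) := Real.rpow_nonneg (Nat.cast_nonneg _) _
  have hK₁le : K₁ ≤ max (max K₁ K₂) (max K₃ K₄) := (le_max_left _ _).trans (le_max_left _ _)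
  have hK₂le : K₂ ≤ max (max K₁ K₂) (max K₃ K₄) := (le_max_right _ _).trans (le_max_left _ _)
  have hK₃le : K₃ ≤ max (max K₁ K₂) (max K₃ K₄) := (le_max_left _ _).trans (le_max_right _ _)
  have hK₄le : K₄ ≤ max (max K₁ K₂) (max K₃ K₄) := (le_max_right _ _).trans (le_max_right _ _)
  by_cases hoff : ((∏ i, ((X i : ℝ) * Y i * Z i)) ≤ 2 * (C₀ : ℝ) ^ (l - 1 + 3 * ε) * ((X i₀ : ℝ) * Y i₀ * Z i₀) ∨
          ((∏ i, ((X i : ℝ) * Y i * Z i)) ≤ 2 * (C₀ : ℝ) ^ (l - 1 + 3 * ε) * ((X i₁ : ℝ) * Y i₁ * Z i₁) ∧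
            (∏ i, ((X i : ℝ) * Y i * Z i)) ^ 3 ≤ 64 * ((C₀ : ℝ) ^ (l - 1 + 3 * ε)) ^ 3 *
              (((c₁ * shapeVal X : ℕ) : ℝ) * ((c₂ * shapeVal Y : ℕ) : ℝ) * ((c₃ * shapeVal Z : ℕ) : ℝ))))
  · exact (hK₁ C₀ c₁ c₂ c₃ X Y Z i₀ i₁ rfl rfl hA hoff).trans (mul_le_mul_of_nonneg_right hK₁le hC)
  have hnw := not_deep_of_depth l ε τ hε.le hε2 (by linarith) hl2 _ C₀ c₁ c₂ c₃ X Y Z hA i₀ i₁ rfl rfl hoff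
  by_cases cX : (∏ i, ((X i : ℝ) * Y i * Z i)) ≤ 2 * (C₀ : ℝ) ^ (l - 1 + 3 * ε) * ((X i₀ : ℝ) * Y i₁ * Z i₁) ∧
      (∏ i, ((X i : ℝ) * Y i * Z i)) ≤ (C₀ : ℝ) ^ (l - 1 + 3 * ε) * ((c₁ * shapeVal X : ℕ) : ℝ)
  · exact (hK₂ C₀ c₁ c₂ c₃ X Y Z i₀ i₁ rfl rfl hA cX).trans (mul_le_mul_of_nonneg_right hK₂le hC)
  by_cases cY : (∏ i, ((X i : ℝ) * Y i * Z i)) ≤ 2 * (C₀ : ℝ) ^ (l - 1 + 3 * ε) * ((Y i₀ : ℝ) * X i₁ * Z i₁) ∧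
      (∏ i, ((X i : ℝ) * Y i * Z i)) ≤ (C₀ : ℝ) ^ (l - 1 + 3 * ε) * ((c₂ * shapeVal Y : ℕ) : ℝ)
  · -- host `Y`: the `X`-law on the swapped datum `(c₂, c₁, c₃; Y, X, Z)`
    have hprod : (∏ i, ((Y i : ℝ) * X i * Z i)) = ∏ i, ((X i : ℝ) * Y i * Z i) :=
      Finset.prod_congr rfl fun i _ => by ring
    have cY' : (∏ i, ((Y i : ℝ) * X i * Z i)) ≤ 2 * (C₀ : ℝ) ^ (l - 1 + 3 * ε) * ((Y i₀ : ℝ) * X i₁ * Z i₁) ∧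
        (∏ i, ((Y i : ℝ) * X i * Z i)) ≤ (C₀ : ℝ) ^ (l - 1 + 3 * ε) * ((c₂ * shapeVal Y : ℕ) : ℝ) := by
      rw [hprod]; exact cY
    have h := hK₂ C₀ c₂ c₁ c₃ Y X Z i₀ i₁ rfl rfl (admissible_swap hA) cY'
    rw [shapeCount_swap]
    exact h.trans (mul_le_mul_of_nonneg_right hK₂le hC)
  by_cases cZ : (∏ i, ((X i : ℝ) * Y i * Z i)) ≤ 2 * (C₀ : ℝ) ^ (l - 1 + 3 * ε) * ((Z i₀ : ℝ) * X i₁ * Y i₁)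
  · exact (hK₃ C₀ c₁ c₂ c₃ X Y Z i₀ i₁ rfl rfl hA cZ).trans (mul_le_mul_of_nonneg_right hK₃le hC)
  have hnc : ¬ (((∏ i, ((X i : ℝ) * Y i * Z i)) ≤ 2 * (C₀ : ℝ) ^ (l - 1 + 3 * ε) * ((X i₀ : ℝ) * Y i₁ * Z i₁) ∧
              (∏ i, ((X i : ℝ) * Y i * Z i)) ≤ (C₀ : ℝ) ^ (l - 1 + 3 * ε) * ((c₁ * shapeVal X : ℕ) : ℝ)) ∨
            ((∏ i, ((X i : ℝ) * Y i * Z i)) ≤ 2 * (C₀ : ℝ) ^ (l - 1 + 3 * ε) * ((Y i₀ : ℝ) * X i₁ * Z i₁) ∧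
              (∏ i, ((X i : ℝ) * Y i * Z i)) ≤ (C₀ : ℝ) ^ (l - 1 + 3 * ε) * ((c₂ * shapeVal Y : ℕ) : ℝ)) ∨
            ((∏ i, ((X i : ℝ) * Y i * Z i)) ≤ 2 * (C₀ : ℝ) ^ (l - 1 + 3 * ε) * ((Z i₀ : ℝ) * X i₁ * Y i₁))) := by
    rintro (h | h | h)
    · exact cX h
    · exact cY h
    · exact cZ h
  exact (hK₄ C₀ c₁ c₂ c₃ X Y Z i₀ i₁ rfl rfl hA hoff hnw hnc).trans (mul_le_mul_of_nonneg_right hK₄le hC)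

/-- **The registered depth `1/4`.** The open stub `stub_nearWallR2` of the skeleton (signature verbatim as the
hypothesis) ALONE gives the Mazur–Kane law at every `s ∈ [15/8, 2)` — the first range below Kane's `s ≥ 2` if the
lever lands; transfer, off-wall and the two two-root laws are the landed theorems of this directory. [folklore] -/
theorem lawAt_tail_of_nearWallR2 : (∀ l : ℝ, 1 < l → l < 2 → ∀ ε : ℝ, 0 < ε → ε < 1 / 2 → ∀ η : ℝ, 0 < η → ∃ K : ℝ, ∀ (C₀ c₁ c₂ c₃ : ℕ) (X Y Z : Fin (Literature.NumberTheory.DiophantineGeometry.AbcShapes.numShapes ε) → ℕ) (i₀ i₁ : Fin (Literature.NumberTheory.DiophantineGeometry.AbcShapes.numShapes ε)), (i₀ : ℕ) = 0 → (i₁ : ℕ) = 1 → Literature.NumberTheory.DiophantineGeometry.AbcShapes.Admissible l ε C₀ c₁ c₂ c₃ X Y Z → ¬ ((∏ i, ((X i : ℝ) * Y i * Z i)) ≤ 2 * (C₀ : ℝ) ^ (l - 1 + 3 * ε) * ((X i₀ : ℝ) * Y i₀ * Z i₀) ∨ ((∏ i, ((X i : ℝ) * Y i * Z i)) ≤ 2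 * (C₀ : ℝ) ^ (l - 1 + 3 * ε) * ((X i₁ : ℝ) * Y i₁ * Z i₁) ∧ (∏ i, ((X i : ℝ) * Y i * Z i)) ^ 3 ≤ 64 * ((C₀ : ℝ) ^ (l - 1 + 3 * ε)) ^ 3 * (((c₁ * Literature.NumberTheory.DiophantineGeometry.AbcShapes.shapeVal X : ℕ) : ℝ) * ((c₂ * Literature.NumberTheory.DiophantineGeometry.AbcShapes.shapeVal Y : ℕ) : ℝ) * ((c₃ * Literature.NumberTheory.DiophantineGeometry.AbcShapes.shapeVal Z : ℕ) : ℝ)))) → ((∏ i, ((X i : ℝ) * Y i * Z i)) ≤ 2 * (C₀ : ℝ) ^ (l - 1 + 3 * ε) * (C₀ : ℝ) ^ (1 / 4 : ℝ) * ((X i₀ : ℝ) * Y i₀ * Z i₀)) → ¬ (((∏ i, ((X i : ℝ) * Y i * Z i)) ≤ 2 * (C₀ : ℝ) ^ (l - 1 + 3 * ε) * ((X i₀ : ℝ) * Y i₁ * Z i₁) ∧ (∏ i, ((X i : ℝ) * Y i * Z i)) ≤ (C₀ : ℝ) ^ (l - 1 + 3 * ε) * ((c₁ * Literature.NumberTheory.DiophantineGeometry.AbcShapes.shapeVal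 X : ℕ) : ℝ)) ∨ ((∏ i, ((X i : ℝ) * Y i * Z i)) ≤ 2 * (C₀ : ℝ) ^ (l - 1 + 3 * ε) * ((Y i₀ : ℝ) * X i₁ * Z i₁) ∧ (∏ i, ((X i : ℝ) * Y i * Z i)) ≤ (C₀ : ℝ) ^ (l - 1 + 3 * ε) * ((c₂ * Literature.NumberTheory.DiophantineGeometry.AbcShapes.shapeVal Y : ℕ) : ℝ)) ∨ ((∏ i, ((X i : ℝ) * Y i * Z i)) ≤ 2 * (C₀ : ℝ) ^ (l - 1 + 3 * ε) * ((Z i₀ : ℝ) * X i₁ * Y i₁))) → (Literature.NumberTheory.DiophantineGeometry.AbcShapes.shapeCount c₁ c₂ c₃ X Y Z : ℝ) ≤ K * (C₀ : ℝ) ^ (l - 1 + 3 * ε + η)) → ∀ s : ℝ, 15 / 8 ≤ s → s < 2 → ∀ ε : ℝ, 0 < ε → ∃ C : ℝ, ∀ N : ℕ, 2 ≤ N → (Set.ncard {t : ℕ × ℕ × ℕ | Literature.NumberTheory.DiophantineGeometry.IsABCTriple t.1 t.2.1 t.2.2 ∧ t.2.2 ≤ N ∧ ((Literature.NumberTheory.DiophantineGeometry.rad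 t.1 t.2.1 t.2.2 : ℕ) : ℝ) ≤ (t.2.2 : ℝ) ^ s} : ℝ) ≤ C * (N : ℝ) ^ (s - 1 + ε) := by
  intro hR s hs hs2
  refine lawAt_tail_of_nearWallR2_depth (1 / 4 : ℝ) ?_ s (by linarith) (by linarith) hs2
  intro l hl1 _ hl2
  exact hR l hl1 hl2

/-- **The composition of the line as a theorem.** The two OPEN registered stubs of the skeleton —
`stub_nearWallR2` (near-wall residue after the two-root tool, linear depth `≤ C₀^{1/4}`) and `stub_deepResidual`
(the foreign residual beyond depth `1/4`) — imply the crux `MazurKaneLaw`; the other four stubs are landed and enter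
by name (`stub_transfer`, `stub_offWall`, `stub_twoRootTameX` + `shapeCount_swap`, `stub_twoRootTameZ`). [folklore] -/
theorem mazurKaneLaw_of_nearWallR2_of_deepResidual : (∀ l : ℝ, 1 < l → l < 2 → ∀ ε : ℝ, 0 < ε → ε < 1 / 2 → ∀ η : ℝ, 0 < η → ∃ K : ℝ, ∀ (C₀ c₁ c₂ c₃ : ℕ) (X Y Z : Fin (Literature.NumberTheory.DiophantineGeometry.AbcShapes.numShapes ε) → ℕ) (i₀ i₁ : Fin (Literature.NumberTheory.DiophantineGeometry.AbcShapes.numShapes ε)), (i₀ : ℕ) = 0 → (i₁ : ℕ) = 1 → Literature.NumberTheory.DiophantineGeometry.AbcShapes.Admissible l ε C₀ c₁ c₂ c₃ X Y Z → ¬ ((∏ i, ((X i : ℝ) * Y i * Z i)) ≤ 2 * (C₀ : ℝ) ^ (l - 1 + 3 * ε) * ((X i₀ : ℝ) * Y i₀ * Z i₀) ∨ ((∏ i, ((X i : ℝ) * Y i * Z i)) ≤ 2 * (C₀ : ℝ) ^ (l - 1 + 3 * ε) * ((X i₁ : ℝ) * Y i₁ * Z i₁) ∧ (∏ i, ((X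 i : ℝ) * Y i * Z i)) ^ 3 ≤ 64 * ((C₀ : ℝ) ^ (l - 1 + 3 * ε)) ^ 3 * (((c₁ * Literature.NumberTheory.DiophantineGeometry.AbcShapes.shapeVal X : ℕ) : ℝ) * ((c₂ * Literature.NumberTheory.DiophantineGeometry.AbcShapes.shapeVal Y : ℕ) : ℝ) * ((c₃ * Literature.NumberTheory.DiophantineGeometry.AbcShapes.shapeVal Z : ℕ) : ℝ)))) → ((∏ i, ((X i : ℝ) * Y i * Z i)) ≤ 2 * (C₀ : ℝ) ^ (l - 1 + 3 * ε) * (C₀ : ℝ) ^ (1 / 4 : ℝ) * ((X i₀ : ℝ) * Y i₀ * Z i₀)) → ¬ (((∏ i, ((X i : ℝ) * Y i * Z i)) ≤ 2 * (C₀ : ℝ) ^ (l - 1 + 3 * ε) * ((X i₀ : ℝ) * Y i₁ * Z i₁) ∧ (∏ i, ((X i : ℝ) * Y i * Z i)) ≤ (C₀ : ℝ) ^ (l - 1 + 3 * ε) * ((c₁ * Literature.NumberTheory.DiophantineGeometry.AbcShapes.shapeVal X : ℕ) : ℝ)) ∨ ((∏ i, ((X i : ℝ) * Y i * Z i)) ≤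 2 * (C₀ : ℝ) ^ (l - 1 + 3 * ε) * ((Y i₀ : ℝ) * X i₁ * Z i₁) ∧ (∏ i, ((X i : ℝ) * Y i * Z i)) ≤ (C₀ : ℝ) ^ (l - 1 + 3 * ε) * ((c₂ * Literature.NumberTheory.DiophantineGeometry.AbcShapes.shapeVal Y : ℕ) : ℝ)) ∨ ((∏ i, ((X i : ℝ) * Y i * Z i)) ≤ 2 * (C₀ : ℝ) ^ (l - 1 + 3 * ε) * ((Z i₀ : ℝ) * X i₁ * Y i₁))) → (Literature.NumberTheory.DiophantineGeometry.AbcShapes.shapeCount c₁ c₂ c₃ X Y Z : ℝ) ≤ K * (C₀ : ℝ) ^ (l - 1 + 3 * ε + η)) → (∀ l : ℝ, 1 < l → l < 2 → ∀ ε : ℝ, 0 < ε → ε < 1 / 2 → ∀ η : ℝ, 0 < η → ∃ K : ℝ, ∀ (C₀ c₁ c₂ c₃ : ℕ) (X Y Z : Fin (Literature.NumberTheory.DiophantineGeometry.AbcShapes.numShapes ε) → ℕ) (i₀ i₁ : Fin (Literature.NumberTheory.DiophantineGeometry.AbcShapes.numShapes ε)), (i₀ : ℕ) = 0 → (i₁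 : ℕ) = 1 → Literature.NumberTheory.DiophantineGeometry.AbcShapes.Admissible l ε C₀ c₁ c₂ c₃ X Y Z → ¬ ((∏ i, ((X i : ℝ) * Y i * Z i)) ≤ 2 * (C₀ : ℝ) ^ (l - 1 + 3 * ε) * ((X i₀ : ℝ) * Y i₀ * Z i₀) ∨ ((∏ i, ((X i : ℝ) * Y i * Z i)) ≤ 2 * (C₀ : ℝ) ^ (l - 1 + 3 * ε) * ((X i₁ : ℝ) * Y i₁ * Z i₁) ∧ (∏ i, ((X i : ℝ) * Y i * Z i)) ^ 3 ≤ 64 * ((C₀ : ℝ) ^ (l - 1 + 3 * ε)) ^ 3 * (((c₁ * Literature.NumberTheory.DiophantineGeometry.AbcShapes.shapeVal X : ℕ) : ℝ) * ((c₂ * Literature.NumberTheory.DiophantineGeometry.AbcShapes.shapeVal Y : ℕ) : ℝ) * ((c₃ * Literature.NumberTheory.DiophantineGeometry.AbcShapes.shapeVal Z : ℕ) : ℝ)))) → ¬ ((∏ i, ((X i : ℝ) * Y i * Z i)) ≤ 2 * (C₀ : ℝ) ^ (l - 1 + 3 * ε) * (C₀ : ℝ) ^ (1 / 4 : ℝ)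 * ((X i₀ : ℝ) * Y i₀ * Z i₀)) → (Literature.NumberTheory.DiophantineGeometry.AbcShapes.shapeCount c₁ c₂ c₃ X Y Z : ℝ) ≤ K * (C₀ : ℝ) ^ (l - 1 + 3 * ε + η)) → Summit.ABC.ABC.Theses.TwistAmplification.MazurKaneLaw := by
  intro hR hD s hs1 hs2
  refine stub_transfer s hs1 hs2 fun l hl1 hl2 => ?_
  intro ε hε hε2 η hη
  have hl0 : 1 < l := lt_trans hs1 hl1
  obtain ⟨K₁, hK₁⟩ := stub_offWall l hl0 hl2 ε hε hε2 η hη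
  obtain ⟨K₂, hK₂⟩ := stub_twoRootTameX l hl0 hl2 ε hε hε2 η hη
  obtain ⟨K₃, hK₃⟩ := stub_twoRootTameZ l hl0 hl2 ε hε hε2 η hη
  obtain ⟨K₄, hK₄⟩ := hR l hl0 hl2 ε hε hε2 η hη
  obtain ⟨K₅, hK₅⟩ := hD l hl0 hl2 ε hε hε2 η hη
  have h2 := two_le_numShapes hε hε2
  refine ⟨max (max (max K₁ K₂) (max K₃ K₄)) K₅, fun C₀ c₁ c₂ c₃ X Y Z hA => ?_⟩
  set i₀ : Fin (numShapes ε) := ⟨0, by omega⟩ with hi₀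
  set i₁ : Fin (numShapes ε) := ⟨1, by omega⟩ with hi₁
  have hC : (0 : ℝ) ≤ (C₀ : ℝ) ^ (l - 1 + 3 * ε + η) := Real.rpow_nonneg (Nat.cast_nonneg _) _
  have hK₁le : K₁ ≤ max (max (max K₁ K₂) (max K₃ K₄)) K₅ :=
    ((le_max_left _ _).trans (le_max_left _ _)).trans (le_max_left _ _)
  have hK₂le : K₂ ≤ max (max (max K₁ K₂) (max K₃ K₄)) K₅ :=
    ((le_max_right _ _).trans (le_max_left _ _)).trans (le_max_left _ _)
  have hK₃le : K₃ ≤ max (max (max K₁ K₂) (max K₃ K₄)) K₅ :=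
    ((le_max_left _ _).trans (le_max_right _ _)).trans (le_max_left _ _)
  have hK₄le : K₄ ≤ max (max (max K₁ K₂) (max K₃ K₄)) K₅ :=
    ((le_max_right _ _).trans (le_max_right _ _)).trans (le_max_left _ _)
  have hK₅le : K₅ ≤ max (max (max K₁ K₂) (max K₃ K₄)) K₅ := le_max_right _ _
  by_cases hoff : ((∏ i, ((X i : ℝ) * Y i * Z i)) ≤ 2 * (C₀ : ℝ) ^ (l - 1 + 3 * ε) * ((X i₀ : ℝ) * Y i₀ * Z i₀) ∨
          ((∏ i, ((X i : ℝ) * Y i * Z i)) ≤ 2 * (C₀ : ℝ) ^ (l - 1 + 3 * ε) * ((X i₁ : ℝ) * Y i₁ * Z i₁) ∧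
            (∏ i, ((X i : ℝ) * Y i * Z i)) ^ 3 ≤ 64 * ((C₀ : ℝ) ^ (l - 1 + 3 * ε)) ^ 3 *
              (((c₁ * shapeVal X : ℕ) : ℝ) * ((c₂ * shapeVal Y : ℕ) : ℝ) * ((c₃ * shapeVal Z : ℕ) : ℝ))))
  · exact (hK₁ C₀ c₁ c₂ c₃ X Y Z i₀ i₁ rfl rfl hA hoff).trans (mul_le_mul_of_nonneg_right hK₁le hC)
  by_cases hnw : ((∏ i, ((X i : ℝ) * Y i * Z i)) ≤
            2 * (C₀ : ℝ) ^ (l - 1 + 3 * ε) * (C₀ : ℝ) ^ (1 / 4 : ℝ) * ((X i₀ : ℝ) * Y i₀ * Z i₀))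
  swap
  · exact (hK₅ C₀ c₁ c₂ c₃ X Y Z i₀ i₁ rfl rfl hA hoff hnw).trans (mul_le_mul_of_nonneg_right hK₅le hC)
  by_cases cX : (∏ i, ((X i : ℝ) * Y i * Z i)) ≤ 2 * (C₀ : ℝ) ^ (l - 1 + 3 * ε) * ((X i₀ : ℝ) * Y i₁ * Z i₁) ∧
      (∏ i, ((X i : ℝ) * Y i * Z i)) ≤ (C₀ : ℝ) ^ (l - 1 + 3 * ε) * ((c₁ * shapeVal X : ℕ) : ℝ)
  · exact (hK₂ C₀ c₁ c₂ c₃ X Y Z i₀ i₁ rfl rfl hA cX).trans (mul_le_mul_of_nonneg_right hK₂le hC)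
  by_cases cY : (∏ i, ((X i : ℝ) * Y i * Z i)) ≤ 2 * (C₀ : ℝ) ^ (l - 1 + 3 * ε) * ((Y i₀ : ℝ) * X i₁ * Z i₁) ∧
      (∏ i, ((X i : ℝ) * Y i * Z i)) ≤ (C₀ : ℝ) ^ (l - 1 + 3 * ε) * ((c₂ * shapeVal Y : ℕ) : ℝ)
  · have hprod : (∏ i, ((Y i : ℝ) * X i * Z i)) = ∏ i, ((X i : ℝ) * Y i * Z i) :=
      Finset.prod_congr rfl fun i _ => by ring
    have cY' : (∏ i, ((Y i : ℝ) * X i * Z i)) ≤ 2 * (C₀ : ℝ) ^ (l - 1 + 3 * ε) * ((Y i₀ : ℝ) * X i₁ * Z i₁) ∧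
        (∏ i, ((Y i : ℝ) * X i * Z i)) ≤ (C₀ : ℝ) ^ (l - 1 + 3 * ε) * ((c₂ * shapeVal Y : ℕ) : ℝ) := by
      rw [hprod]; exact cY
    have h := hK₂ C₀ c₂ c₁ c₃ Y X Z i₀ i₁ rfl rfl (admissible_swap hA) cY'
    rw [shapeCount_swap]
    exact h.trans (mul_le_mul_of_nonneg_right hK₂le hC)
  by_cases cZ : (∏ i, ((X i : ℝ) * Y i * Z i)) ≤ 2 * (C₀ : ℝ) ^ (l - 1 + 3 * ε) * ((Z i₀ : ℝ) * X i₁ * Y i₁)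
  · exact (hK₃ C₀ c₁ c₂ c₃ X Y Z i₀ i₁ rfl rfl hA cZ).trans (mul_le_mul_of_nonneg_right hK₃le hC)
  have hnc : ¬ (((∏ i, ((X i : ℝ) * Y i * Z i)) ≤ 2 * (C₀ : ℝ) ^ (l - 1 + 3 * ε) * ((X i₀ : ℝ) * Y i₁ * Z i₁) ∧
              (∏ i, ((X i : ℝ) * Y i * Z i)) ≤ (C₀ : ℝ) ^ (l - 1 + 3 * ε) * ((c₁ * shapeVal X : ℕ) : ℝ)) ∨
            ((∏ i, ((X i : ℝ) * Y i * Z i)) ≤ 2 * (C₀ : ℝ) ^ (l - 1 + 3 * ε) * ((Y i₀ : ℝ) * X i₁ * Z i₁) ∧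
              (∏ i, ((X i : ℝ) * Y i * Z i)) ≤ (C₀ : ℝ) ^ (l - 1 + 3 * ε) * ((c₂ * shapeVal Y : ℕ) : ℝ)) ∨
            ((∏ i, ((X i : ℝ) * Y i * Z i)) ≤ 2 * (C₀ : ℝ) ^ (l - 1 + 3 * ε) * ((Z i₀ : ℝ) * X i₁ * Y i₁))) := by
    rintro (h | h | h)
    · exact cX h
    · exact cY h
    · exact cZ h
  exact (hK₄ C₀ c₁ c₂ c₃ X Y Z i₀ i₁ rfl rfl hA hoff hnw hnc).trans (mul_le_mul_of_nonneg_right hK₄le hC)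

end Summit.ABC.ABC.Theorems.MazurKaneLaw

end
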